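import Mathlib
import HarnessLib
import Summits.HubbardSuperconductivity.HubbardSuperconductivity.Theorems.WeakCouplingBCSWcbcsKohnLuttingerB1gNotB1gLeaf
import Summits.HubbardSuperconductivity.HubbardSuperconductivity.Theorems.WeakCouplingBCSDefsKlCertB1gWinDRecord
import Summits.HubbardSuperconductivity.HubbardSuperconductivity.Theorems.ChiralWindowCwThesisChannelInfNonpos
import Summits.HubbardSuperconductivity.HubbardSuperconductivity.Theorems.ChiralWindowCwKLChiralWindowBottomStates
import Summits.HubbardSuperconductivity.HubbardSuperconductivity.Theorems.WeakCouplingBCSKlDualOrderBracketD005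
import Summits.HubbardSuperconductivity.HubbardSuperconductivity.Theorems.WeakCouplingBCSKlDualOrderBracketD035

/-!
# Route `WeakCouplingBCS` / `KLProgramme` — HQ1 (ii): the END-VALUE leaves at `t′ = 0` and the end-to-end ORDERED PAIR
# `m(δ = 0.35) < m(δ = 0.05)` of the Kohn–Luttinger rival margin (cheapest certified instance; cell gate-hubbard-kl, idea-3 r18)

HONEST LABEL OF RECORD (pen (R435)(A), verbatim): «an ORDER statement between two δ-windows at t′ = 0, MODULO (i)
`klCertB1gWinD.EnclosuresB1g` (the landed window record's hypothesis) and (ii) `RoutePB1gFloorD035` (route-P form floors on three U1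
cells of j272077, certified in the cert-2 stretch4 tables, not re-derived in Lean); LINE-brick, VARIANT/new-combination (r1 + r2 + idea-2
L5 + idea-1 C16 + CERT-RITZ route P); nothing about t′ ≠ 0, K₃, U₀ or superconductivity; printed BESIDE W3′ DECIDED and the (δ) record,
replacing nothing».  RULE-CERT: `RoutePB1gFloorD035` is a NEW NAMED RECORD HYPOTHESIS (a kit-derived literal enters Lean only as a named
hypothesis with a provenance line); it is NOT discharged in Lean and carries no DECIDED label.  In this file it is the explicit hypothesis TERM
`B1gFormFloor (-4431/5000) (-353/400) (-33/500)` of `marginOrderT0_d005_d035(_of_routeP)` and the target «MarginOrderT0_d005_d035» is the term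
`MarginOrderT0 (1/20) (7/20)` (parameterless `Prop` definitions in `Theorems/` files are relocated to `Literature/` by the gate, so the two names are
labels, not declarations; margin-1 g17 filing note).  PROVENANCE of its three literals: field
`channels.B1g.K_bottom_interval_perchannel[0]` (= `dn(min(channels.B1g.LB_matrix, 0) − min(B_N, E_1D))` per `routeP4.py` 17ffffb6df01eb77 l.362/437–438, here equal to
`LB_matrix − E_1D` since `E_1D ≈ 0.0095 < B_N ≈ 0.0137` and `LB < 0`; CERT-RITZ §2.1 (c)–(d): per-isotypic HS defect `E_1D`, interval-Cholesky `LB`) of `HOME/hubbard-kl-cert-2/stretch4/data/cells/j272077/<cell>/routeP-<cell>.json`, cells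
`m0.88635-0.88490-N416` / `m0.88510-0.88365-N416` / `m0.88385-0.88240-N416`: `-0.06538940216420212 / -0.06564313687473279 /
-0.06589592825450832` verbatim, rounded OUTWARD to `−33/500 = −0.066` on the union `[−4431/5000, −353/400] = [−0.8862, −0.8825]`
(byte check = (R435)(A) leg 2 on the bus; the coarser `B_N`-based `channels.B1g.K_bottom_interval[0]` = `-0.0696… / -0.0699… / -0.0701…`
would give `−71/1000` and still close, `0.071 < 0.105`).
A Kohn–Luttinger `O(U²)` channel statement is not ODLRO; nothing here proves superconductivity in the Hubbard model.

`m(μ) = rivalMargin μ = min (λ_A2g, λ_B2g, λ_E)(μ) − λ_B1g(μ)` at `U = 1` (tree decl, `…Theorems.KlNotB1g.rivalMargin`,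
p674753).  The dual reading of the certified margin table: a FLOOR `γ' ≤ m` on a μ-interval is what the positive
records already certify (multiplicity-aware checker `checkB1gD`, `klb1gd_box_certificate`), box by box and with the
box's OWN margin instead of the window minimum; a CEILING `m ≤ κ` is what ONE role-swapped record certifies — a
Ritz row for ONE rival `χ ∈ {A2g, B2g, E}` and a certified lower row for `B1g` (the data of the negative leaf
`notB1gCheck`, read for its VALUE `rhohi(χ) − lower(B1g) ≤ κ` instead of its sign).  `κ < γ'` then orders the two
intervals STRICTLY, end to end, with no monotonicity, no transport in `μ` and no comparison of kernels.

§1 cover bookkeeping (generic, proved) · §2 the FLOOR sub-record of an accepted `D`-record at a sharper margin (proved)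
and its kernel instance on the top two boxes `[−0.08, −0.075]` of `klCertB1gWinD` with `γ' = 21/200` (6.2× the window's
exported `gamma = 17751/2²⁰`; modulo the record's OWN named hypothesis `klCertB1gWinD.EnclosuresB1g`, nothing new) ·
§3 the END-VALUE leaf (proved: `endValueCheck c χ κ → EnclosuresNotB1g c χ → ∀ μ ∈ window, m(μ) ≤ κ`) · §3b the
`B1g`-ONLY ceiling (idea-2 r6 L5's «trivial order certificate» made a checker, proved: every channel bottom is `≤ 0` —
tree theorem `CwThesis.stub_channelInfNonpos` — so `m(μ) ≤ −λ_B1g(μ) ≤ s_B1g`; ONE far row of the `B1g` block per cell,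
no rival row, no Ritz hypothesis) · §3c the ADDITIVE-kind ceiling (route-P currency: a form floor `Λ_B1g` on normalised
`B1g` states, hypothesis (iii) of `wcbcsKohnLuttingerB1g_of_numerical_certificate`, gives `m ≤ −Λ_B1g`; proved from built
modules via `kl_bs_pairingForm_eq`) · §4 the order composition and the `δ`-form `MarginOrderT0 δ₁ δ₂` with its reduction
to two filling brackets (proved) · §5 END TO END in existing currencies: `marginOrderT0_d005_d035_of_routeP` — floor §2
(landed record) + ceiling §3c fed by the route-P rows ALREADY ON HOME for the three `U1` cells of j272077 covering
`μ(0.35) ∈ [−0.8862, −0.8825]` (`Λ_B1g ≥ −33/500`, ceiling `0.066 < 0.105`) + the two brackets (kernel-certified in the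
companion files `WeakCouplingBCSKlDualOrderBracketD005|D035.lean`, farm rc 0): zero kit, zero fetch.

HISTORY: rev 1 of this sketch WANTED an END record at `δ = 0.35` (role-swapped stage-2 rows on the `U1` cells of j272077, archived hull
tables) — superseded: the route-P rows already on HOME give the ceiling (§3c/§5); that END record would be a second currency only.
The μ-brackets are the companion modules `…KlDualOrderBracketD005` / `…KlDualOrderBracketD035` (the latter split Upper/Lower/Bracket).

Honest framing: a KL `O(U²)` channel statement is not ODLRO; nothing here asserts a margin at `t′ ≠ 0`, `K₃`, `U₀`, the
window or superconductivity; nothing here proves superconductivity in the Hubbard model.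
-/

noncomputable section
set_option linter.dupNamespace false

namespace Summit.HubbardSuperconductivity.HubbardSuperconductivity.Theorems

open Literature.MathematicalPhysics.QuantumLattice
open Summit.HubbardSuperconductivity.HubbardSuperconductivity.Theorems.CwKLChiralWindow
open Summit.HubbardSuperconductivity.HubbardSuperconductivity.Theorems.KlNotB1g

namespace KlDualOrder

/-! ## §1 Cover bookkeeping (generic) -/

/-- A box list covers `[a, b]`: first box starts at or below `a`, last box ends at or above `b`, consecutive boxes touch
(`KLCert.chainOK`). Kernel-decidable. [folklore] -/
def coverCheck (L : List KLBox) (a b : ℚ) : Bool :=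
  (match L.head?, L.getLast? with
    | some b₀, some b₁ => decide (b₀.mulo ≤ a) && decide (b ≤ b₁.muhi)
    | _, _ => false) &&
  KLCert.chainOK L

/-- **Cover logic** (verbatim the bookkeeping of `klb1gd_coverLogic` / `kl_cvl_chain_cover`): every real `μ ∈ [a, b]`
lies in some box of an accepted list. [folklore] -/
theorem cover_of_coverCheck (L : List KLBox) (a b : ℚ) (h : coverCheck L a b = true) :
    ∀ μ : ℝ, ((a : ℚ) : ℝ) ≤ μ → μ ≤ ((b : ℚ) : ℝ) →
      ∃ bx ∈ L, ((bx.mulo : ℚ) : ℝ) ≤ μ ∧ μ ≤ ((bx.muhi : ℚ) : ℝ) := by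
  unfold coverCheck at h
  simp only [Bool.and_eq_true] at h
  obtain ⟨hmatch, hchain⟩ := h
  intro μ hμ₁ hμ₂
  split at hmatch
  · rename_i b₀ b₁ hb₀ hb₁
    simp only [Bool.and_eq_true, decide_eq_true_eq] at hmatch
    obtain ⟨L', hL⟩ := List.head?_eq_some_iff.1 hb₀
    rw [hL] at hchain hb₁ ⊢
    have hlo : ((b₀.mulo : ℚ) : ℝ) ≤ μ := le_trans (by exact_mod_cast hmatch.1) hμ₁
    have hhi : μ ≤ ((b₁.muhi : ℚ) : ℝ) := le_trans hμ₂ (by exact_mod_cast hmatch.2)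
    exact kl_cvl_chain_cover L' b₀ b₁ hchain hb₁ μ hlo hhi
  · exact absurd hmatch Bool.false_ne_true

/-! ## §2 The FLOOR of the rival margin from an accepted `D`-record, box by box, at a sharper margin `γ'` -/

/-- The boxes of a record whose left end is `≥ a` (a top sub-window). [folklore] -/
def floorBoxes (c : KLCert) (a : ℚ) : List KLBox :=
  c.boxes.filter fun bx => decide (a ≤ bx.mulo)

/-- **The floor checker**: the top sub-window's boxes cover `[a, b]`, and each passes the multiplicity-aware box test of
`checkB1gD` with the SHARPER margin `γ'` (`basicOKB1gD ∧ b1gLeadsOK γ'`). Kernel-decidable. [folklore] -/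
def floorCheck (c : KLCert) (a b γ' : ℚ) : Bool :=
  coverCheck (floorBoxes c a) a b &&
    ((floorBoxes c a).all fun bx => bx.basicOKB1gD c.trials && bx.b1gLeadsOK c.trials γ')

/-- From `B1g + γ' ≤ χ` for the four `χ ≠ B1g` to `γ' ≤ rivalMargin`. [folklore] -/
theorem le_rivalMargin_of_leads {μ : ℝ} {γ' : ℝ}
    (h : ∀ χ : D4Irrep, χ ≠ D4Irrep.B1g →
      channelInf (squareDispersion 1 0) μ 1 D4Irrep.B1g + γ' ≤ channelInf (squareDispersion 1 0) μ 1 χ) :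
    γ' ≤ rivalMargin μ := by
  have hA2 := h D4Irrep.A2g (by decide)
  have hB2 := h D4Irrep.B2g (by decide)
  have hEE := h D4Irrep.E (by decide)
  unfold rivalMargin
  have h1 : channelInf (squareDispersion 1 0) μ 1 D4Irrep.B1g + γ' ≤
      min (min (channelInf (squareDispersion 1 0) μ 1 D4Irrep.A2g) (channelInf (squareDispersion 1 0) μ 1 D4Irrep.B2g))
        (channelInf (squareDispersion 1 0) μ 1 D4Irrep.E) :=
    le_min (le_min hA2 hB2) hEE
  linarith

/-- **Soundness of the floor checker**: on `[a, b]`, `γ' ≤ m(μ)`, modulo the record's OWN named hypothesis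
`c.EnclosuresB1g` (restricted to the sub-window's boxes; `klb1gd_box_certificate` box by box). [folklore] -/
theorem le_rivalMargin_of_floorCheck (c : KLCert) (a b γ' : ℚ) (hc : floorCheck c a b γ' = true)
    (hE : c.EnclosuresB1g) :
    ∀ μ ∈ Set.Icc ((a : ℚ) : ℝ) ((b : ℚ) : ℝ), ((γ' : ℚ) : ℝ) ≤ rivalMargin μ := by
  unfold floorCheck at hc
  simp only [Bool.and_eq_true] at hc
  obtain ⟨hcov, hall⟩ := hc
  intro μ hμ
  obtain ⟨bx, hbx, hlo, hhi⟩ := cover_of_coverCheck (floorBoxes c a) a b hcov μ hμ.1 hμ.2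
  have hbx' : bx ∈ c.boxes := List.mem_of_mem_filter hbx
  have hBL := List.all_eq_true.1 hall bx hbx
  simp only [Bool.and_eq_true] at hBL
  obtain ⟨hB, hL⟩ := hBL
  obtain ⟨hER, hEχ⟩ := hE bx hbx' μ ⟨hlo, hhi⟩
  exact le_rivalMargin_of_leads (klb1gd_box_certificate bx c.trials γ' hB hL ⟨hlo, hhi⟩ hER hEχ)

/-- **Kernel instance (zero kit): the top two boxes `[−2/25, −31/400]`, `[−31/400, −3/40]` of the landed window record
`klCertB1gWinD` pass the floor checker with `γ' = 21/200 = 0.105`** (the window exports only its minimum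
`gamma = 17751/2²⁰ ≈ 0.0169`). [folklore] -/
theorem winD_top_floorCheck : floorCheck klCertB1gWinD (-2 / 25) (-3 / 40) (21 / 200) = true := by
  decide +kernel

/-- **FLOOR of record at `δ ≈ 0.05`**: `0.105 ≤ m(μ)` for every `μ ∈ [−0.08, −0.075]` (`∋ μ(0.05) ≈ −0.0776`), modulo
`klCertB1gWinD.EnclosuresB1g` — the hypothesis the window theorem `klCertB1gWinD_window_U` already carries. [folklore] -/
theorem winD_top_floor (hE : klCertB1gWinD.EnclosuresB1g) :
    ∀ μ ∈ Set.Icc (((-2 / 25 : ℚ) : ℚ) : ℝ) (((-3 / 40 : ℚ) : ℚ) : ℝ), (((21 / 200 : ℚ) : ℚ) : ℝ) ≤ rivalMargin μ :=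
  le_rivalMargin_of_floorCheck klCertB1gWinD (-2 / 25) (-3 / 40) (21 / 200) winD_top_floorCheck hE

/-! ## §3 The END-VALUE leaf: a CEILING of the rival margin from ONE role-swapped record -/

/-- **END-value box test** (the data of `notB1gBoxOK`, read for its value): box well formed, the rival block `χ`
carries usable Ritz rows, the `B1g` block a certified lower row (`lowerOKd`), and `rhohi(χ) − lower(B1g) ≤ κ`. [folklore] -/
def endValueBoxOK (bx : KLBox) (tab : List KLTrig) (χ : D4Irrep) (κ : ℚ) : Bool :=
  decide (-4 < bx.mulo) && decide (bx.mulo ≤ bx.muhi) && decide (bx.muhi < 0) &&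
    (bx.blk χ).ritzOK tab χ && bx.bB1g.lowerOKd tab .B1g &&
    decide ((bx.blk χ).rhohi - bx.bB1g.lower tab .B1g ≤ κ)

/-- **The END-value checker**: `χ ∉ {B1g, A1g}`, window ends `-4 < mub ≤ mua < 0`, boxes covering `[mub, mua]`, and
`endValueBoxOK χ κ` on every box. Kernel-decidable. [folklore] -/
def endValueCheck (c : KLCert) (χ : D4Irrep) (κ : ℚ) : Bool :=
  isRivalB χ && decide (-4 < c.mub) && decide (c.mub ≤ c.mua) && decide (c.mua < 0) &&
    coverCheck c.boxes c.mub c.mua &&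
    (c.boxes.all fun bx => endValueBoxOK bx c.trials χ κ)

/-- **Box certificate of the END-value leaf** (`U = 1`): `m(μ) ≤ λ_χ − λ_B1g ≤ rhohi(χ) − lower(B1g) ≤ κ`
(`rivalMargin_le`, `klb1g_ritz_upper`, `klb1gd_blockLower`). [folklore] -/
theorem rivalMargin_le_of_endValueBoxOK {μ : ℝ} (bx : KLBox) (tab : List KLTrig) (χ : D4Irrep) (κ : ℚ)
    (hχ : IsRival χ) (hB : endValueBoxOK bx tab χ κ = true)
    (hμ : μ ∈ Set.Icc ((bx.mulo : ℚ) : ℝ) ((bx.muhi : ℚ) : ℝ))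
    (hER : (bx.blk χ).RitzEnclosure tab μ) (hEB : bx.bB1g.Enclosure tab μ D4Irrep.B1g) :
    rivalMargin μ ≤ ((κ : ℚ) : ℝ) := by
  unfold endValueBoxOK at hB
  simp only [Bool.and_eq_true, decide_eq_true_eq] at hB
  obtain ⟨⟨⟨⟨⟨h4, -⟩, h0⟩, hR⟩, hL⟩, hle⟩ := hB
  have hμo : μ ∈ Set.Ioo (-4 : ℝ) 0 :=
    ⟨lt_of_lt_of_le (by exact_mod_cast h4) hμ.1, lt_of_le_of_lt hμ.2 (by exact_mod_cast h0)⟩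
  have hup := klb1g_ritz_upper hμo (bx.blk χ) tab χ hR (Or.inr hχ.2) hER
  have hlow := klb1gd_blockLower hμo bx.bB1g tab D4Irrep.B1g hEB hL
  have hle' : (((bx.blk χ).rhohi : ℚ) : ℝ) - ((bx.bB1g.lower tab .B1g : ℚ) : ℝ) ≤ ((κ : ℚ) : ℝ) := by
    exact_mod_cast hle
  have hm := rivalMargin_le μ hχ
  linarith

/-- **FIRST LEMMA — soundness of the END-value leaf.** A record accepted by `endValueCheck χ κ`, with the enclosures of
the negative leaf (`EnclosuresNotB1g`: Ritz rows of the rival block, block enclosure of the `B1g` block — existing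
hypothesis kind), certifies the CEILING `m(μ) ≤ κ` uniformly on its window. [folklore] -/
theorem rivalMargin_le_of_endValueCheck (c : KLCert) (χ : D4Irrep) (κ : ℚ)
    (hc : endValueCheck c χ κ = true) (hE : EnclosuresNotB1g c χ) :
    ∀ μ ∈ Set.Icc ((c.mub : ℚ) : ℝ) ((c.mua : ℚ) : ℝ), rivalMargin μ ≤ ((κ : ℚ) : ℝ) := by
  unfold endValueCheck at hc
  simp only [Bool.and_eq_true, decide_eq_true_eq] at hc
  obtain ⟨⟨⟨⟨⟨hr, -⟩, -⟩, -⟩, hcov⟩, hall⟩ := hc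
  intro μ hμ
  obtain ⟨bx, hbx, hlo, hhi⟩ := cover_of_coverCheck c.boxes c.mub c.mua hcov μ hμ.1 hμ.2
  obtain ⟨hER, hEB⟩ := hE bx hbx μ ⟨hlo, hhi⟩
  exact rivalMargin_le_of_endValueBoxOK bx c.trials χ κ (isRival_of_isRivalB hr)
    (List.all_eq_true.1 hall bx hbx) ⟨hlo, hhi⟩ hER hEB

/-! ## §3b The `B1g`-ONLY ceiling (one far row per cell; idea-2 r6 L5 as a checker) -/

/-- **`B1g`-only ceiling box test**: box well formed, the `B1g` block carries a certified lower row (`lowerOKd`: Temple or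
far data), and `−lower(B1g) ≤ κ`. [folklore] -/
def b1gCeilBoxOK (bx : KLBox) (tab : List KLTrig) (κ : ℚ) : Bool :=
  decide (-4 < bx.mulo) && decide (bx.mulo ≤ bx.muhi) && decide (bx.muhi < 0) &&
    bx.bB1g.lowerOKd tab .B1g && decide (-(bx.bB1g.lower tab .B1g) ≤ κ)

/-- **The `B1g`-only ceiling checker**: window ends, cover, and `b1gCeilBoxOK κ` on every box. Kernel-decidable. [folklore] -/
def b1gCeilCheck (c : KLCert) (κ : ℚ) : Bool :=
  decide (-4 < c.mub) && decide (c.mub ≤ c.mua) && decide (c.mua < 0) &&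
    coverCheck c.boxes c.mub c.mua &&
    (c.boxes.all fun bx => b1gCeilBoxOK bx c.trials κ)

/-- **The named numerical hypothesis of the `B1g`-only ceiling** (minimal: the block enclosure of the `B1g` block on every
box, of which only the deflated square mass row E4 is read by a far block). [folklore] -/
def EnclosuresB1gFloor (c : KLCert) : Prop :=
  ∀ bx ∈ c.boxes, ∀ μ ∈ Set.Icc (bx.mulo : ℝ) (bx.muhi : ℝ), bx.bB1g.Enclosure c.trials μ D4Irrep.B1g

/-- **Soundness of the `B1g`-only ceiling**: `m(μ) ≤ λ_A2g(μ) − λ_B1g(μ) ≤ 0 − lower(B1g) ≤ κ` on the window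
(`rivalMargin_le`, `CwThesis.stub_channelInfNonpos`, `klb1gd_blockLower`). [folklore] -/
theorem rivalMargin_le_of_b1gCeilCheck (c : KLCert) (κ : ℚ) (hc : b1gCeilCheck c κ = true)
    (hE : EnclosuresB1gFloor c) :
    ∀ μ ∈ Set.Icc ((c.mub : ℚ) : ℝ) ((c.mua : ℚ) : ℝ), rivalMargin μ ≤ ((κ : ℚ) : ℝ) := by
  unfold b1gCeilCheck at hc
  simp only [Bool.and_eq_true, decide_eq_true_eq] at hc
  obtain ⟨⟨⟨⟨-, -⟩, -⟩, hcov⟩, hall⟩ := hc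
  intro μ hμ
  obtain ⟨bx, hbx, hlo, hhi⟩ := cover_of_coverCheck c.boxes c.mub c.mua hcov μ hμ.1 hμ.2
  have hB := List.all_eq_true.1 hall bx hbx
  unfold b1gCeilBoxOK at hB
  simp only [Bool.and_eq_true, decide_eq_true_eq] at hB
  obtain ⟨⟨⟨⟨h4, -⟩, h0⟩, hL⟩, hle⟩ := hB
  have hμo : μ ∈ Set.Ioo (-4 : ℝ) 0 :=
    ⟨lt_of_lt_of_le (by exact_mod_cast h4) hlo, lt_of_le_of_lt hhi (by exact_mod_cast h0)⟩
  have hlow := klb1gd_blockLower hμo bx.bB1g c.trials D4Irrep.B1g (hE bx hbx μ ⟨hlo, hhi⟩) hL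
  have hA2 : channelInf (squareDispersion 1 0) μ 1 D4Irrep.A2g ≤ 0 := CwThesis.stub_channelInfNonpos 1 D4Irrep.A2g hμo
  have hm := rivalMargin_le μ (χ := D4Irrep.A2g) ⟨by decide, by decide⟩
  have hle' : -((bx.bB1g.lower c.trials .B1g : ℚ) : ℝ) ≤ ((κ : ℚ) : ℝ) := by exact_mod_cast hle
  linarith

/-! ## §3c The ADDITIVE-kind ceiling (route-P currency; numbers already on HOME, zero kit, zero fetch)

The cell's second certified currency — Route P (CERT-RITZ §2; `routeP4.certify`: interval-Cholesky bottom `LB_χ` of the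
Galerkin matrix on hull-enclosed entries plus the certified Hilbert–Schmidt defect `E_χ`) — delivers per μ-cell a LOWER
bound `Λ_χ = LB_χ − E_χ` of the Lindhard form on normalised `χ` states, i.e. exactly hypothesis (iii) of the tree's
additive certificate theorem `wcbcsKohnLuttingerB1g_of_numerical_certificate`.  Read for the `B1g` block it is a
CEILING datum: `m(μ) ≤ 0 − λ_B1g(μ) ≤ −Λ_B1g`.  On the three `U1` cells of j272077 covering `[−0.8862, −0.8825]`
(`routeP-m0.88635-0.88490|m0.88510-0.88365|m0.88385-0.88240-N416.json`, field `K_bottom_interval_perchannel.B1g`):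
`Λ_B1g = −0.065389 / −0.065643 / −0.065896 ≥ −33/500`. -/

/-- **The additive-kind numerical hypothesis** (route-P currency): on `[a, b]` the `B1g` Lindhard form on normalised
`B1g` channel states is `≥ Λ` — hypothesis (iii) of `wcbcsKohnLuttingerB1g_of_numerical_certificate` restricted to
`χ = B1g`. [folklore] -/
def B1gFormFloor (a b Λ : ℚ) : Prop :=
  ∀ μ ∈ Set.Icc ((a : ℚ) : ℝ) ((b : ℚ) : ℝ), ∀ ψ, IsChannelState (squareDispersion 1 0) μ D4Irrep.B1g ψ →
    ((Λ : ℚ) : ℝ) ≤ ∫ k, ψ k * ∫ k', lindhardFunction (squareDispersion 1 0) μ (k + k') * ψ k'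
      ∂fermiCurveMeasure (squareDispersion 1 0) μ ∂fermiCurveMeasure (squareDispersion 1 0) μ

/-- **A form floor is a floor of `channelInf` at `U = 1`** (`B1g`): the pairing form of a `B1g` channel state at `U = 1` IS the
Lindhard form (`kl_bs_pairingForm_eq`), so `Λ ≤` every value and hence `Λ ≤ sInf` (an empty state set gives the junk value
`0 ≥ Λ`).  The `U = 1` case of `sq_mul_le_channelInf_of_hs`, proved here from built modules only. [folklore] -/
theorem le_channelInf_b1g_of_formFloor {μ Λ : ℝ} (hμ : μ ∈ Set.Ioo (-4 : ℝ) 0) (hΛ : Λ ≤ 0)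
    (hlow : ∀ ψ, IsChannelState (squareDispersion 1 0) μ D4Irrep.B1g ψ →
      Λ ≤ ∫ k, ψ k * ∫ k', lindhardFunction (squareDispersion 1 0) μ (k + k') * ψ k'
        ∂fermiCurveMeasure (squareDispersion 1 0) μ ∂fermiCurveMeasure (squareDispersion 1 0) μ) :
    Λ ≤ channelInf (squareDispersion 1 0) μ 1 D4Irrep.B1g := by
  unfold channelInf
  set S := pairingForm (squareDispersion 1 0) μ 1 '' {ψ | IsChannelState (squareDispersion 1 0) μ D4Irrep.B1g ψ}
    with hS
  rcases S.eq_empty_or_nonempty with hSe | hSne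
  · rw [hSe, Real.sInf_empty]
    exact hΛ
  · apply le_csInf hSne
    rintro _ ⟨ψ, hψ, rfl⟩
    rw [kl_bs_pairingForm_eq hμ (by decide) hψ]
    exact hlow ψ hψ

/-- **Soundness of the additive-kind ceiling**: `B1gFormFloor a b Λ` with `Λ ≤ 0`, `[a, b] ⊂ (−4, 0)` gives
`m(μ) ≤ −Λ` on `[a, b]` (`le_channelInf_b1g_of_formFloor`, `CwThesis.stub_channelInfNonpos` for `A2g`, `rivalMargin_le`).
[folklore] -/
theorem rivalMargin_le_of_b1gFormFloor (a b Λ : ℚ) (h4 : -4 < a) (h0 : b < 0) (hΛ : Λ ≤ 0)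
    (hF : B1gFormFloor a b Λ) :
    ∀ μ ∈ Set.Icc ((a : ℚ) : ℝ) ((b : ℚ) : ℝ), rivalMargin μ ≤ -((Λ : ℚ) : ℝ) := by
  intro μ hμ
  have hμo : μ ∈ Set.Ioo (-4 : ℝ) 0 :=
    ⟨lt_of_lt_of_le (by exact_mod_cast h4) hμ.1, lt_of_le_of_lt hμ.2 (by exact_mod_cast h0)⟩
  have hΛ' : ((Λ : ℚ) : ℝ) ≤ 0 := by exact_mod_cast hΛ
  have hB : ((Λ : ℚ) : ℝ) ≤ channelInf (squareDispersion 1 0) μ 1 D4Irrep.B1g :=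
    le_channelInf_b1g_of_formFloor hμo hΛ' (hF μ hμ)
  have hA2 : channelInf (squareDispersion 1 0) μ 1 D4Irrep.A2g ≤ 0 := CwThesis.stub_channelInfNonpos 1 D4Irrep.A2g hμo
  have hm := rivalMargin_le μ (χ := D4Irrep.A2g) ⟨by decide, by decide⟩
  linarith

/-! ## §4 The ordered pair -/

/-- **Order composition**: a ceiling `κ` on `I₂`, a floor `γ'` on `I₁` and `κ < γ'` order the margins strictly, end to
end. [folklore] -/
theorem rivalMargin_lt_of_ceiling_floor {I₁ I₂ : Set ℝ} {γ' κ : ℝ} (hκ : κ < γ')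
    (hfloor : ∀ μ ∈ I₁, γ' ≤ rivalMargin μ) (hceil : ∀ μ ∈ I₂, rivalMargin μ ≤ κ) :
    ∀ μ₁ ∈ I₁, ∀ μ₂ ∈ I₂, rivalMargin μ₂ < rivalMargin μ₁ := by
  intro μ₁ h₁ μ₂ h₂
  have a := hfloor μ₁ h₁
  have b := hceil μ₂ h₂
  linarith

/-- The `δ`-form a consumer reads: at `t′ = 0` the rival margin at hole doping `δ₂` is STRICTLY SMALLER than at `δ₁`
(`μ(δ) = chemicalPotentialOfDensity ε₀ (1 − δ)`, normalisation `U = 1`; `U²`-homogeneity makes it every `U`). [folklore] -/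
def MarginOrderT0 (δ₁ δ₂ : ℝ) : Prop :=
  rivalMargin (chemicalPotentialOfDensity (squareDispersion 1 0) (1 - δ₂)) <
    rivalMargin (chemicalPotentialOfDensity (squareDispersion 1 0) (1 - δ₁))

/-- **Reduction of the target to the two records and two brackets.** Given (i) the floor `γ'` on `[a₁, b₁]` (here: §2,
`γ' = 21/200` on `[−2/25, −3/40]`), (ii) an END-value record `cend` for a rival `χ` with ceiling `κ < γ'` (WANTED: the
role-swapped rows on the `U1` cells of j272077), and (iii) the brackets `μ(19/20) ∈ [a₁, b₁]`, `μ(13/20) ∈ [cend.mub, cend.mua]`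
(two filling certificates each; `19/20 ≤ n(−3/40)` and `n(−357/400) < 13/20` are in the tree), the target follows. [folklore] -/
theorem marginOrderT0_d005_d035_of_records
    (a₁ b₁ γ' κ : ℚ) (hκ : κ < γ')
    (hfloor : ∀ μ ∈ Set.Icc ((a₁ : ℚ) : ℝ) ((b₁ : ℚ) : ℝ), ((γ' : ℚ) : ℝ) ≤ rivalMargin μ)
    (cend : KLCert) (χ : D4Irrep) (hc : endValueCheck cend χ κ = true) (hE : EnclosuresNotB1g cend χ)
    (hμ₁ : chemicalPotentialOfDensity (squareDispersion 1 0) (1 - 1 / 20) ∈ Set.Icc ((a₁ : ℚ) : ℝ) ((b₁ : ℚ) : ℝ))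
    (hμ₂ : chemicalPotentialOfDensity (squareDispersion 1 0) (1 - 7 / 20) ∈
      Set.Icc ((cend.mub : ℚ) : ℝ) ((cend.mua : ℚ) : ℝ)) :
    MarginOrderT0 (1 / 20) (7 / 20) := by
  have hκ' : ((κ : ℚ) : ℝ) < ((γ' : ℚ) : ℝ) := by exact_mod_cast hκ
  exact rivalMargin_lt_of_ceiling_floor hκ' hfloor (rivalMargin_le_of_endValueCheck cend χ κ hc hE) _ hμ₁ _ hμ₂

/-! ## §5 END TO END in existing currencies (zero kit, zero fetch)

Floor: §2 (`klCertB1gWinD`, Ritz/far currency, kernel).  Ceiling: §3c fed by the route-P rows of the three `U1` cells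
(additive currency, `Λ_B1g ≥ −33/500`).  Brackets: `μ(0.05) ∈ [−2/25, −3/40]` and `μ(0.35) ∈ [−4431/5000, −353/400]`, both
kernel-certified in the companion files `WeakCouplingBCSKlDualOrderBracketD005|D035.lean` (theorems
`muOfDoping_d005_mem_Icc`, `muOfDoping_d035_mem_Icc`; pre-staged, farm rc 0) — taken here as hypotheses of exactly those
types so that this scratch module checks against the tree alone. -/

/-- **HQ1 (ii), cheapest instance, END TO END** (target «MarginOrderT0_d005_d035» = `MarginOrderT0 (1/20) (7/20)`): `m(δ = 0.35) < m(δ = 0.05)`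
at `t′ = 0`, modulo the landed record's own `EnclosuresB1g` (Ritz/far kind) and ONE route-P form floor (additive kind) — the named record
hypothesis «RoutePB1gFloorD035» := `B1gFormFloor (−4431/5000) (−353/400) (−33/500)` (in-seat certified by j272077 stage 2: `−0.065389 / −0.065643 /
−0.065896 ≥ −0.066` on the three covering cells; provenance in the module docstring), written as an explicit hypothesis TERM because
parameterless `Prop` definitions in `Theorems/` files are relocated to `Literature/` by the gate; the two bracket hypotheses are the statements of
`muOfDoping_d005_mem_Icc` / `muOfDoping_d035_mem_Icc`.  Numbers: floor `21/200 = 0.105` > ceiling `33/500 = 0.066`. [folklore] -/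
theorem marginOrderT0_d005_d035_of_routeP (hE : klCertB1gWinD.EnclosuresB1g)
    (hF : B1gFormFloor (-4431 / 5000) (-353 / 400) (-33 / 500))
    (hμ₁ : chemicalPotentialOfDensity (squareDispersion 1 0) (1 - 1 / 20) ∈ Set.Icc (-(2 : ℝ) / 25) (-(3 : ℝ) / 40))
    (hμ₂ : chemicalPotentialOfDensity (squareDispersion 1 0) (1 - 7 / 20) ∈
      Set.Icc (-(4431 : ℝ) / 5000) (-(353 : ℝ) / 400)) :
    MarginOrderT0 (1 / 20) (7 / 20) := by
  have hceil := rivalMargin_le_of_b1gFormFloor (-4431 / 5000) (-353 / 400) (-33 / 500)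
    (by norm_num) (by norm_num) (by norm_num) hF
  have hfloor := winD_top_floor hE
  have hμ₁' : chemicalPotentialOfDensity (squareDispersion 1 0) (1 - 1 / 20) ∈
      Set.Icc ((((-2 : ℚ) / 25 : ℚ)) : ℝ) ((((-3 : ℚ) / 40 : ℚ)) : ℝ) :=
    ⟨by push_cast; linarith [hμ₁.1], by push_cast; linarith [hμ₁.2]⟩
  have hμ₂' : chemicalPotentialOfDensity (squareDispersion 1 0) (1 - 7 / 20) ∈
      Set.Icc ((((-4431 : ℚ) / 5000 : ℚ)) : ℝ) ((((-353 : ℚ) / 400 : ℚ)) : ℝ) :=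
    ⟨by push_cast; linarith [hμ₂.1], by push_cast; linarith [hμ₂.2]⟩
  have hκ : -((((-33 : ℚ) / 500 : ℚ)) : ℝ) < ((((21 : ℚ) / 200 : ℚ)) : ℝ) := by push_cast; norm_num
  exact rivalMargin_lt_of_ceiling_floor hκ hfloor hceil _ hμ₁' _ hμ₂'

/-- Sanity (kernel): the floor `21/200` is `6.2×` the window's exported `gamma`, and the by-value ceiling band `[1/20, 3/50]`
sits below it by `≥ 9/200`. [folklore] -/
example : 6 * klCertB1gWinD.gamma < (21 : ℚ) / 200 ∧ (3 : ℚ) / 50 + 9 / 200 ≤ 21 / 200 := by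
  refine ⟨by decide +kernel, by norm_num⟩

/-- **END TO END, brackets discharged** — `m(δ = 7/20) < m(δ = 1/20)` at `t' = 0` modulo the two numerical hypothesis KINDS only:
(i) `klCertB1gWinD.EnclosuresB1g` (Ritz/far kind, the landed window record's own hypothesis) and (ii) `RoutePB1gFloorD035` (additive
kind, route-P form floor `Λ_B1g ≥ −33/500` on `[−4431/5000, −353/400]`).  The two μ-brackets are the kernel-certified companion theorems
`muOfDoping_d005_mem_Icc` (`…KlDualOrderBracketD005`) and `muOfDoping_d035_mem_Icc` (`…KlDualOrderBracketD035`).  Honest label of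
record: see the module docstring. [folklore] -/
theorem marginOrderT0_d005_d035 (hE : klCertB1gWinD.EnclosuresB1g)
    (hF : B1gFormFloor (-4431 / 5000) (-353 / 400) (-33 / 500)) : MarginOrderT0 (1 / 20) (7 / 20) :=
  marginOrderT0_d005_d035_of_routeP hE hF muOfDoping_d005_mem_Icc muOfDoping_d035_mem_Icc

end KlDualOrder

end Summit.HubbardSuperconductivity.HubbardSuperconductivity.Theorems

end
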